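import Summits.AnomalousDissipation.AnomalousDissipation.Theses.MirrorEnsemble
import Summits.AnomalousDissipation.AnomalousDissipation.Theorems.MirrorStatisticsLoudTG.Negative.LoadBearing
import Summits.AnomalousDissipation.AnomalousDissipation.Theorems.MirrorEnsembleMirrorStatisticsLoudTGStubResidualK
import Summits.AnomalousDissipation.AnomalousDissipation.Theorems.MirrorEnsembleMirrorStatisticsLoudTGStubTameClosureK
import Summits.AnomalousDissipation.AnomalousDissipation.Theorems.MirrorEnsembleMirrorStatisticsLoudTGStubEulerCoerciveKTools
import Summits.AnomalousDissipation.AnomalousDissipation.Theorems.MirrorEnsembleMirrorStatisticsLoudTGStubTubeProfilesK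
import Summits.AnomalousDissipation.AnomalousDissipation.Theorems.MirrorEnsembleMirrorStatisticsLoudTGStubOddPoincareK
import Summits.AnomalousDissipation.AnomalousDissipation.Theorems.MirrorEnsembleMirrorStatisticsLoudTGStubTubeLawSmoothK
import Summits.AnomalousDissipation.AnomalousDissipation.Theorems.MirrorEnsembleMirrorStatisticsLoudTGStubTubeLawTransferK
import HarnessLib

/-!
# Line `regimes` — crux `MirrorEnsemble.MirrorStatisticsLoudTG` (stmt-AnomalousDissipation-17693)
# The MIRROR ENSTROPHY-REGIME split of L_K, keeping the viscosity: residual transfer + K-tame closure +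
# K-Euler coercivity (Kelvin-armed) + rough loudness (crux-strategist b1, 2026-08-17)

L_K (fixed): for `f = f_TG` and every level `E` there are `ε₀, ν₀ > 0` such that every stationary statistical
solution `μ` of NS_ν(f_TG), `0 < ν < ν₀`, with integrable energy, `e(μ) ≤ E` and carried by the closed mirror class
`Fix K` has `ν G(μ) ≥ ε₀` (`G` = mean enstrophy).

THE SPLIT. A violating family `(ν_n → 0, μ_n)` is either TAME (`G(μ_n)` bounded along a subsequence) or ROUGH
(`G(μ_n) → ∞`). The line discharges the tame regime through three pieces native to the mirror arena and isolates
the rough regime as the heart: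

* `stub_residualK` (S–M, PROVABLE NOW) — every SSS of NS_ν(f_TG) is a forced-EULER near-statistics with cylindrical
  defect `≤ ν √G` (instance of the landed `ResidualTransferSSS_of`, f_TG smooth/div-free/mean-zero by the landed
  `isSmooth_tgForce` …). It turns a tame quiet family into tame near-statistics with defect `r → 0`.
* `stub_tameClosureK` (L, provable in kind; the K-supported copy of `TameRoughRigidity.TameClosure` stmt-18402) —
  K-supported tame near-statistics (energy `≤ E`, mean enstrophy `≤ G₁`, defect `→ 0`) close up on an EXACT
  K-supported stationary statistical solution of forced Euler with the same bounds (Chebyshev + Rellich tightness,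
  Prokhorov, cut-off cylindrical tests; `Fix K` is closed; the shell inequality by `v ↦ −v` symmetrisation, which
  preserves `Fix K`). Risk: Reynolds stress escaping to infinite energy (the item-18402 caveat, shared verbatim).
* `stub_eulerCoerciveK` (OPEN, Kelvin-attackable; strictly weaker than the f_TG copy of `GPEulerCoercive` 18400) —
  `f_TG` carries NO K-supported stationary statistical solution of forced Euler in the FMRT class. NEW LEVER (this
  line's first lemma, `Sketch.lean` of the strategist folder / card): the STATISTICAL KELVIN TUBE LAW — testing the
  mean momentum balance (landed `stub_linearTestLimit` at defect 0) against the smoothed line current `g_δ` of the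
  skeleton loop `C = ∂[0,½]²×{x₂=0}` (`(f_TG, g_δ) → ∮_C f_TG·dl = 4/π`) and the deterministic TUBE INEQUALITY
  `|∫(u·∇u)·g_δ| ≤ C δ⁻¹ ‖∇u‖²_{L²(N_δ(C))}` for K-symmetric `H¹` fields (normal components vanish on the symmetry
  planes ⇒ one-dimensional Hardy on `[0, δ]`; the longitudinal term is a perfect derivative up to corner boxes) gives
  `E_μ ‖∇u‖²_{L²(N_δ(C))} ≥ c δ` for EVERY `δ > 0`: an exact K-Euler statistics must carry an EDGE CUSP of enstrophy
  on the skeleton, so none is supported on fields with `∇u ∈ L^{4+}` near `C` (in particular none on `C¹` fields —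
  the statistical form of PumpedMirror's `NoSmoothMirrorDodgerTG`, covering orbit measures of smooth recurrent
  K-symmetric Euler dynamics as well as steady states). Open residue: cusped tame K-Euler statistics.
* `stub_roughLoudK` (OPEN, the HEART) — above a mean-enstrophy threshold `G₁(E)` bounded K-statistics of NS_ν(f_TG)
  are loud: the K41 content of L_K over genuine SSS (ν kept: no noise-fakes, exact Liouville for NS_ν, shell energy
  inequality available), the only regime inhabited once the tame one is excluded.
* `mirrorStatisticsLoudTG_of_regimes` — L_K from the four stubs (≈ 45 tactic lines, sorry-free): by contradiction a
  tame bounded K-family along `ν → 0` gives, through `stub_residualK`, near-statistics of every defect `r > 0`;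
  `stub_tameClosureK` closes them on an exact K-Euler statistics, which `stub_eulerCoerciveK` forbids; so below some
  `ν₁(E, G₁)` every bounded K-statistics has `G ≥ G₁` and `stub_roughLoudK` applies. `MirrorStatisticsLoudTG_of`
  concludes the crux BY NAME (`crux_iff` of `Negative/LoadBearing` strips the sugar binder `∀ f, f = f_TG →`).

LOSSLESSNESS. L_K ⇒ `stub_roughLoudK` (drop a hypothesis) and L_K ⇒ "no tame bounded K-family" (`νG ≤ νG₁ → 0`), so
the split is an equivalence up to the two provable pieces; `stub_eulerCoerciveK` is necessary for L_K restricted to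
Dirac masses (kill switch `not_mirrorStatisticsLoudTG_of_quietSteadyStates` with `ν`-independent tame steady states).

RELATION TO THE BIRTH LINE (`StubResidualTG → StubMirrorRigidityTG`): the ν-free mirror rigidity implies all four
stubs' open content; this line CUTS that single open stub by regime and keeps `ν` on the rough side.

## Status (lead prover-line-stmt-AnomalousDissipation-17693-0, cycle 1, 2026-08-17T12:1xZ)
* S1 `stub_residualK` — LANDED p158132 (`Theorems/MirrorEnsembleMirrorStatisticsLoudTGStubResidualK.lean`).
* S2 `stub_tameClosureK` — LANDED p158692 (`Theorems/MirrorEnsembleMirrorStatisticsLoudTGStubTameClosureK.lean`, 370 lines: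
  `tightLimitK` = Prokhorov limit keeps the K-support by the open-complement portmanteau; `symmetriseK` = time-reversal
  normal form keeps it because `Fix K` and its closure are `v ↦ −v`-invariant).
* S3 `stub_eulerCoerciveK` — OPEN; entry lemmas LANDED p159112 as the tools sub-stub `stub_eulerCoerciveKTools`
  (`Theorems/MirrorEnsembleMirrorStatisticsLoudTGStubEulerCoerciveKTools.lean`: `meanMomentumBalance`, `meanReynoldsStress`,
  `meanStress_tg` (= −¼), `energyFloor_tg`, `closure_mirrorClass_eq`, `ae_mem_mirrorClass`, `tg_loop_circulation` (= 4/π),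
  `dirac_iff`, `skeletonLaw_of_tubeInequality`). Residue: (i) the TUBE INEQUALITY on `Fix K ∩ {finite enstrophy}`
  (provable in kind, M–L); (ii) the NO-CUSP estimate (open): K-Euler statistics with edge-cusp enstrophy density
  ≍ dist(·,C)⁻¹ on the skeleton loop are not excluded by any tool in the tree.
* RESHAPE (lead, cycle 1, `ledger skeleton check` 2026-08-17T13:1xZ): S3 is DERIVED (`eulerCoerciveK_of_tubeLaw`, sorry-free)
  from four provable stubs T1 `stub_tubeProfilesK` / T2a `stub_oddPoincareK` / T2b `stub_tubeLawSmoothK` /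
  T3 `stub_tubeLawTransferK` (the statistical Kelvin tube law) and the OPEN lossless residue S3b `stub_noCuspK`.
* WAVE 2 (lead, cycle 1): T1 LANDED p161955 (+tools p161748), T2a LANDED p161745, T2b LANDED p162841 (+tools p162458,
  p162459), T3 LANDED p162214 (+tools p161948); the composed STATISTICAL KELVIN TUBE LAW (edge-cusp law for K-supported Euler
  statistics of f_TG) is landed standalone as `stub_skeletonCuspLawK` (`Theorems/MirrorEnsembleMirrorStatisticsLoudTGSkeletonCuspLawK.lean`,
  p163182). REMAINING: S3b `stub_noCuspK` (OPEN) and S4 `stub_roughLoudK` (OPEN) — L_K ⇐ S3b ∧ S4, everything else proved.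
* S4 `stub_roughLoudK` — OPEN (the heart; held by the lead).

## Disproof used
No cdisprove `Disproof.lean` exists for this crux yet (2026-08-17T09Z). From `Negative/LoadBearing` (rattack): the SSS
clause is load-bearing (`mirrorStatisticsLoudTG_false_without_sss`) — consumed in `stub_residualK`/`stub_roughLoudK`,
which keep `IsStationaryStatisticalSolution` verbatim; `Integrable ‖v‖²` is redundant (`loudAtNoInt_iff`) — kept only
to match the crux; constants window `ε₀ ≤ ½√E` — respected (`ε₀(E)` comes from `stub_roughLoudK`, level-wise, no
uniformity in `E` claimed); kill switch (quiet bounded steady K-states) — tame ones land in `stub_eulerCoerciveK`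
(their strong `L²` limits are K-symmetric steady weak Euler states in `V` with `(f,u) ≥ 0`, i.e. Dirac K-Euler SSS),
rough ones (`G_n → ∞`, e.g. `ν^{1/3}` edge layers) in `stub_roughLoudK`. Negatives index (6 entries): none is a
statement about statistics of f_TG.
-/

set_option linter.dupNamespace false

noncomputable section

namespace Summit.AnomalousDissipation.AnomalousDissipation.Cruxes.MirrorStatisticsLoudTG.Regimes

open MeasureTheory
open scoped ENNReal InnerProductSpace
open Literature.Analysis.FunctionSpaces Literature.Analysis.FluidPDE
open Summit.AnomalousDissipation.AnomalousDissipation.Theses.MirrorEnsemble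
open Summit.AnomalousDissipation.AnomalousDissipation.Theorems.TaylorGreenLoudGalerkinStates.Negative (tgForce)
open Summit.AnomalousDissipation.AnomalousDissipation.Theorems.MirrorStatisticsLoudTG.Negative
  (mirrorClass LoudAt crux_iff)

/-- Local notation: the energy space `H` of `T³`. -/
local notation "H3" => Torus.energySpace (Fin 3)

/-! ## Stubs -/

/-- **S1 `stub_residualK`** (provable now, S–M) — RESIDUAL TRANSFER AT f_TG: every stationary statistical solution of
NS_ν(f_TG), `ν > 0`, with integrable energy is a forced-Euler near-statistics with cylindrical defect `≤ ν√G`: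
`|∫ ⟨f_TG − B(v,v), Φ'(v)⟩ dμ| ≤ ν (G(μ))^{1/2} (∫ ‖∇Φ'(v)‖² dμ)^{1/2}` for every cylindrical `Φ` (integrand integrable).
Proof: `ResidualTransferSSS_of ν tgForce μ hν isSmooth_tgForce isDivFree_tgForce hasZeroMean_tgForce hμ hint |>.2`.
[FMRTTurbulence2001, Ch. IV (1.29)–(1.31)] -/
theorem stub_residualK :
    ∀ (ν : ℝ) (μ : Measure H3), 0 < ν → Torus.IsStationaryStatisticalSolution ν tgForce μ →
      Integrable (fun v : H3 => ‖v‖ ^ 2) μ →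
      ∀ Φ : Torus.CylindricalTest (Fin 3),
        Integrable (fun v : H3 => Torus.nsGeneratorPairing 0 tgForce v (Φ.grad v)) μ ∧
          |∫ v, Torus.nsGeneratorPairing 0 tgForce v (Φ.grad v) ∂μ| ≤
            ν * Real.sqrt (Torus.ensembleEnstrophy μ).toReal *
              Real.sqrt (∫ v, Torus.gradNormSq (Φ.grad v) ∂μ) :=
  -- LANDED p158132 (Theorems/MirrorEnsembleMirrorStatisticsLoudTGStubResidualK.lean)
  Summit.AnomalousDissipation.AnomalousDissipation.Theorems.MirrorEnsembleMirrorStatisticsLoudTG.stub_residualK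

/-- **S2 `stub_tameClosureK`** (provable in kind, L) — K-SUPPORTED TAME CLOSURE: at every energy level `E` and
mean-enstrophy level `G₁`, if K-supported tame near-statistics of forced Euler (probability, integrable energy
`≤ E`, mean enstrophy `≤ G₁`, carried by `closure Fix K`, cylindrical defect `≤ r`) exist for every `r > 0`, then an
exact K-supported stationary statistical solution of Euler forced by f_TG with the same bounds exists.
Plan: Chebyshev + Rellich (balls of `V` are compact in `H`) give tightness, Prokhorov a weak limit; `Fix K` and its
closure are closed; energy and enstrophy are lsc; limit exactness through cut-off cylindrical tests
`χ(|P_K v|²/ρ)·Φ`; shell inequality at `ν = 0` (shell work `≥ 0`) after symmetrising under `v ↦ −v` (Euler is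
time-reversible, `Fix K` is a subspace). Risk (= item 18402's): a Reynolds stress escaping to infinite energy.
[FMRTTurbulence2001, arXiv:1305.7089, arXiv:1411.3391] -/
theorem stub_tameClosureK :
    ∀ E G₁ : ℝ,
      (∀ r : ℝ, 0 < r → ∃ μ : Measure H3, IsProbabilityMeasure μ ∧
        Integrable (fun v : H3 => ‖v‖ ^ 2) μ ∧ Torus.ensembleEnergy μ ≤ E ∧
        Torus.ensembleEnstrophy μ ≤ ENNReal.ofReal G₁ ∧ μ (closure mirrorClass)ᶜ = 0 ∧
        (∀ Φ : Torus.CylindricalTest (Fin 3),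
          Integrable (fun v : H3 => Torus.nsGeneratorPairing 0 tgForce v (Φ.grad v)) μ ∧
            |∫ v, Torus.nsGeneratorPairing 0 tgForce v (Φ.grad v) ∂μ| ≤
              r * Real.sqrt (∫ v, Torus.gradNormSq (Φ.grad v) ∂μ))) →
      ∃ μ : Measure H3, Torus.IsStationaryStatisticalSolution 0 tgForce μ ∧
        Integrable (fun v : H3 => ‖v‖ ^ 2) μ ∧ Torus.ensembleEnergy μ ≤ E ∧
        Torus.ensembleEnstrophy μ ≤ ENNReal.ofReal G₁ ∧ μ (closure mirrorClass)ᶜ = 0 :=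
  -- LANDED p158692 (Theorems/MirrorEnsembleMirrorStatisticsLoudTGStubTameClosureK.lean)
  Summit.AnomalousDissipation.AnomalousDissipation.Theorems.MirrorEnsembleMirrorStatisticsLoudTG.stub_tameClosureK

/-! ### S3 reshaped (lead, cycle 1): the statistical Kelvin tube law + the cusped residue

`stub_eulerCoerciveK` (no K-supported Euler statistics of f_TG) is OPEN. It is cut, losslessly, into four
provable pieces T1/T2a/T2b/T3 — the STATISTICAL KELVIN TUBE LAW on the skeleton loop `C = ∂([0,½]²×{x₂ = 0})` — and
the open residue S3b `stub_noCuspK`; `eulerCoerciveK_of_tubeLaw` below composes them with the landed glue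
`skeletonLaw_of_tubeInequality` (tools p159112). Lossless: S3 ⇒ S3b vacuously, so S3b ⇔ S3 given T1–T3.

Common objects (inlined in every signature so that the registered stubs are self-contained):
* profiles `ρ η : ℝ → ℝ`, smooth and 1-periodic; `ρ` a plateau of the cell side `[2δ, ½ − 2δ]` with `ρ' ≠ 0` only
  in `(δ, 2δ) ∪ (½ − 2δ, ½ − δ)`, `η` a bump of width `δ` at the integers; the TUBE CURRENT
  `g(x) = (η(x₂) ρ(x₀) ρ'(x₁), −η(x₂) ρ'(x₀) ρ(x₁), 0)` (coordinates `Torus.repr x ∈ [0,1)³`), automatically solenoidal;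
* the SKELETON TUBE `N_δ = {‖x₂‖ ≤ δ} ∩ ({‖x₀‖ ≤ 2δ} ∪ {‖x₀ − ½‖ ≤ 2δ} ∪ {‖x₁‖ ≤ 2δ} ∪ {‖x₁ − ½‖ ≤ 2δ})`
  (`‖·‖` the quotient norm of `ℝ/ℤ`), of volume `O(δ²)`;
* local enstrophy of a smooth `v`: `∫_{N_δ} ∑ⱼ ‖∂ⱼ v‖²`; of a finite-enstrophy class `v ∈ H`: `∫⁻_{N_δ} ∑ⱼ ‖wⱼ‖ₑ²` for
  its `L²` weak partial derivatives `wⱼ` (`Torus.HasWeakPartialDeriv`, unique a.e.).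
-/

/-- **T1 `stub_tubeProfilesK`** (provable now, M) — THE TUBE CURRENT OF THE SKELETON LOOP: for every small `δ` there
are smooth 1-periodic profiles `ρ` (plateau of `[2δ, ½−2δ]`, `|ρ| ≤ 1`, `|ρ'| ≤ A/δ`, `ρ' = 0` off
`(δ,2δ) ∪ (½−2δ, ½−δ)` mod 1) and `η` (bump at the integers of width `δ`, `|η| ≤ A/δ`) such that the tube current
`g = (η(x₂)ρ(x₀)ρ'(x₁), −η(x₂)ρ'(x₀)ρ(x₁), 0)` is a smooth solenoidal mean-zero field with `(f_TG, g) ≥ 1`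
(`(f_TG, g) = 4π (∫ η cos 2π·) (∫ ρ sin 2π·)² → 4/π · ∫η` by Stokes / Fubini). Constants `A, δ₁` uniform.
(`Real.smoothTransition` plateaus, periodisation; `integral_fintype_prod_eq_prod`.) [folklore] -/
theorem stub_tubeProfilesK :
    ∃ A δ₁ : ℝ, 1 ≤ A ∧ 0 < δ₁ ∧ δ₁ ≤ 16⁻¹ ∧ ∀ δ : ℝ, 0 < δ → δ ≤ δ₁ →
      ∃ ρ η : ℝ → ℝ, ContDiff ℝ (⊤ : ℕ∞) ρ ∧ ContDiff ℝ (⊤ : ℕ∞) η ∧ Function.Periodic ρ 1 ∧ Function.Periodic η 1 ∧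
        (∀ t, |η t| ≤ A / δ) ∧ (∀ t, |ρ t| ≤ 1) ∧ (∀ t, |deriv ρ t| ≤ A / δ) ∧
        (∀ t, δ ≤ t → t ≤ 1 - δ → η t = 0) ∧
        (∀ t, 0 ≤ t → t ≤ 1 → deriv ρ t ≠ 0 → (δ < t ∧ t < 2 * δ) ∨ (2⁻¹ - 2 * δ < t ∧ t < 2⁻¹ - δ)) ∧
        Torus.IsSmooth (fun x : UnitAddTorus (Fin 3) =>
          !₂[η (Torus.repr x 2) * ρ (Torus.repr x 0) * deriv ρ (Torus.repr x 1),
             -(η (Torus.repr x 2) * deriv ρ (Torus.repr x 0) * ρ (Torus.repr x 1)), (0 : ℝ)]) ∧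
        Torus.IsDivFree (fun x : UnitAddTorus (Fin 3) =>
          !₂[η (Torus.repr x 2) * ρ (Torus.repr x 0) * deriv ρ (Torus.repr x 1),
             -(η (Torus.repr x 2) * deriv ρ (Torus.repr x 0) * ρ (Torus.repr x 1)), (0 : ℝ)]) ∧
        Torus.HasZeroMean (fun x : UnitAddTorus (Fin 3) =>
          !₂[η (Torus.repr x 2) * ρ (Torus.repr x 0) * deriv ρ (Torus.repr x 1),
             -(η (Torus.repr x 2) * deriv ρ (Torus.repr x 0) * ρ (Torus.repr x 1)), (0 : ℝ)]) ∧
        1 ≤ ∫ x, ⟪tgForce x, !₂[η (Torus.repr x 2) * ρ (Torus.repr x 0) * deriv ρ (Torus.repr x 1),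
             -(η (Torus.repr x 2) * deriv ρ (Torus.repr x 0) * ρ (Torus.repr x 1)), (0 : ℝ)]⟫_ℝ :=
  -- LANDED p161955 (Theorems/MirrorEnsembleMirrorStatisticsLoudTGStubTubeProfilesK.lean)
  Summit.AnomalousDissipation.AnomalousDissipation.Theorems.MirrorEnsembleMirrorStatisticsLoudTG.stub_tubeProfilesK

/-- **T2a `stub_oddPoincareK`** (provable now, M) — LOCAL POINCARÉ ACROSS A SYMMETRY PLANE: a smooth function on `T³`
that is odd under `xᵢ ↦ −xᵢ` vanishes on the planes `xᵢ = 0` and `xᵢ = ½`, so on the slabs `‖xᵢ‖ ≤ a`,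
`‖xᵢ − ½‖ ≤ a` one has `∫ φ u² ≤ a² ∫ φ (∂ᵢu)²` for every bounded measurable weight `φ ≥ 0` not depending on `xᵢ`
(FTC on each line + Cauchy–Schwarz: `u(t)² ≤ |t| ∫₀ᵗ (∂ᵢu)²`; Fubini along `𝐞ᵢ`). [folklore] -/
theorem stub_oddPoincareK :
    ∀ (i : Fin 3) (a : ℝ) (u φ : UnitAddTorus (Fin 3) → ℝ), 0 < a → a ≤ 4⁻¹ → Torus.IsSmooth u →
      (∀ x, u (Function.update x i (-x i)) = -u x) → Measurable φ → (∀ x, 0 ≤ φ x) →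
      (∃ B : ℝ, ∀ x, φ x ≤ B) → (∀ (x : UnitAddTorus (Fin 3)) (t : UnitAddCircle), φ (Function.update x i t) = φ x) →
      (∫ x in {x : UnitAddTorus (Fin 3) | ‖x i‖ ≤ a}, φ x * u x ^ 2 ≤
          a ^ 2 * ∫ x in {x : UnitAddTorus (Fin 3) | ‖x i‖ ≤ a}, φ x * Torus.partialDeriv i u x ^ 2) ∧
      (∫ x in {x : UnitAddTorus (Fin 3) | ‖x i - ((2⁻¹ : ℝ) : UnitAddCircle)‖ ≤ a}, φ x * u x ^ 2 ≤
          a ^ 2 * ∫ x in {x : UnitAddTorus (Fin 3) | ‖x i - ((2⁻¹ : ℝ) : UnitAddCircle)‖ ≤ a},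
            φ x * Torus.partialDeriv i u x ^ 2) :=
  -- LANDED p161745 (Theorems/MirrorEnsembleMirrorStatisticsLoudTGStubOddPoincareK.lean)
  Summit.AnomalousDissipation.AnomalousDissipation.Theorems.MirrorEnsembleMirrorStatisticsLoudTG.stub_oddPoincareK

/-- **T2b `stub_tubeLawSmoothK`** (provable now, L) — THE DETERMINISTIC TUBE INEQUALITY FOR SMOOTH MIRROR FIELDS:
given the local Poincaré lemma T2a, there is `K` such that for all profiles `ρ, η` as in T1 (constant `A ≥ 1`,
width `δ ≤ 1/16`) and every smooth solenoidal mean-zero EXACTLY K-symmetric field `v`,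
`|∫ ⟪∇g(x) v(x), v(x)⟫| ≤ K A³ δ⁻¹ ∫_{N_δ} ∑ⱼ ‖∂ⱼv‖²`. Proof: integrate by parts to `−∫ ((v·∇)v)·g`
(`div v = 0`); transversal terms `vⱼ ∂ⱼv_k g_k` (`j` normal to the edge): `vⱼ` is odd across the plane `xⱼ ∈ {0,½}`,
T2a on the slab of width `2δ` gives the factor `δ`, `|g| ≤ A²/δ²`; longitudinal term `v₀∂₀v₀ g₀ = ∂₀(v₀²/2) g₀`:
integrate by parts onto `∂₀g₀ = η ρ'(x₀) ρ'(x₁)`, supported in the corner boxes where `v₀` is odd across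
`x₀ ∈ {0,½}`: T2a again. [folklore] -/
theorem stub_tubeLawSmoothK :
    (∀ (i : Fin 3) (a : ℝ) (u φ : UnitAddTorus (Fin 3) → ℝ), 0 < a → a ≤ 4⁻¹ → Torus.IsSmooth u →
      (∀ x, u (Function.update x i (-x i)) = -u x) → Measurable φ → (∀ x, 0 ≤ φ x) →
      (∃ B : ℝ, ∀ x, φ x ≤ B) → (∀ (x : UnitAddTorus (Fin 3)) (t : UnitAddCircle), φ (Function.update x i t) = φ x) →
      (∫ x in {x : UnitAddTorus (Fin 3) | ‖x i‖ ≤ a}, φ x * u x ^ 2 ≤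
          a ^ 2 * ∫ x in {x : UnitAddTorus (Fin 3) | ‖x i‖ ≤ a}, φ x * Torus.partialDeriv i u x ^ 2) ∧
      (∫ x in {x : UnitAddTorus (Fin 3) | ‖x i - ((2⁻¹ : ℝ) : UnitAddCircle)‖ ≤ a}, φ x * u x ^ 2 ≤
          a ^ 2 * ∫ x in {x : UnitAddTorus (Fin 3) | ‖x i - ((2⁻¹ : ℝ) : UnitAddCircle)‖ ≤ a},
            φ x * Torus.partialDeriv i u x ^ 2)) →
    ∃ K : ℝ, 0 < K ∧ ∀ (A δ : ℝ) (ρ η : ℝ → ℝ), 1 ≤ A → 0 < δ → δ ≤ 16⁻¹ →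
      ContDiff ℝ (⊤ : ℕ∞) ρ → ContDiff ℝ (⊤ : ℕ∞) η → Function.Periodic ρ 1 → Function.Periodic η 1 →
      (∀ t, |η t| ≤ A / δ) → (∀ t, |ρ t| ≤ 1) → (∀ t, |deriv ρ t| ≤ A / δ) →
      (∀ t, δ ≤ t → t ≤ 1 - δ → η t = 0) →
      (∀ t, 0 ≤ t → t ≤ 1 → deriv ρ t ≠ 0 → (δ < t ∧ t < 2 * δ) ∨ (2⁻¹ - 2 * δ < t ∧ t < 2⁻¹ - δ)) →
      ∀ v : UnitAddTorus (Fin 3) → EuclideanSpace ℝ (Fin 3), Torus.IsSmooth v → Torus.IsDivFree v →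
        Torus.HasZeroMean v →
        (∀ (i j : Fin 3) (x : UnitAddTorus (Fin 3)), v (Function.update x i (-x i)) j = if j = i then -(v x j) else v x j) →
        |∫ x, ⟪Torus.fderiv (fun y : UnitAddTorus (Fin 3) =>
            !₂[η (Torus.repr y 2) * ρ (Torus.repr y 0) * deriv ρ (Torus.repr y 1),
               -(η (Torus.repr y 2) * deriv ρ (Torus.repr y 0) * ρ (Torus.repr y 1)), (0 : ℝ)]) x (v x), v x⟫_ℝ| ≤
          K * A ^ 3 / δ * ∫ x in {x : UnitAddTorus (Fin 3) | ‖x 2‖ ≤ δ ∧ (‖x 0‖ ≤ 2 * δ ∨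
              ‖x 0 - ((2⁻¹ : ℝ) : UnitAddCircle)‖ ≤ 2 * δ ∨ ‖x 1‖ ≤ 2 * δ ∨ ‖x 1 - ((2⁻¹ : ℝ) : UnitAddCircle)‖ ≤ 2 * δ)},
            ∑ j, ‖Torus.partialDeriv j v x‖ ^ 2 :=
  -- LANDED p162841 (Theorems/MirrorEnsembleMirrorStatisticsLoudTGStubTubeLawSmoothK.lean)
  Summit.AnomalousDissipation.AnomalousDissipation.Theorems.MirrorEnsembleMirrorStatisticsLoudTG.stub_tubeLawSmoothK

/-- **T3 `stub_tubeLawTransferK`** (provable now, M–L) — TRANSFER TO FINITE-ENSTROPHY MIRROR CLASSES: a tube inequality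
`|∫ ⟪∇g v, v⟫| ≤ (C/δ) ∫_N ∑ⱼ‖∂ⱼv‖²` valid for all smooth solenoidal mean-zero exactly K-symmetric fields passes to
every `v ∈ Fix K` of finite enstrophy, with the local enstrophy of its `L²` weak partial derivatives (any majorant
`Λv` of it): smooth K-symmetric solenoidal approximants (symmetric mollification / spectral truncation) converge in
`L²` together with their gradients (`memSobolev_nat_iff_hasWeakPartialDeriv_holds`, uniqueness of weak derivatives,
`Torus.continuous_inertialPairing`). [folklore] -/
theorem stub_tubeLawTransferK :
    ∀ (C δ : ℝ) (g : UnitAddTorus (Fin 3) → EuclideanSpace ℝ (Fin 3)), 0 ≤ C → 0 < δ → Torus.IsSmooth g →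
      (∀ v : UnitAddTorus (Fin 3) → EuclideanSpace ℝ (Fin 3), Torus.IsSmooth v → Torus.IsDivFree v →
        Torus.HasZeroMean v →
        (∀ (i j : Fin 3) (x : UnitAddTorus (Fin 3)), v (Function.update x i (-x i)) j = if j = i then -(v x j) else v x j) →
        |∫ x, ⟪Torus.fderiv g x (v x), v x⟫_ℝ| ≤
          C / δ * ∫ x in {x : UnitAddTorus (Fin 3) | ‖x 2‖ ≤ δ ∧ (‖x 0‖ ≤ 2 * δ ∨
              ‖x 0 - ((2⁻¹ : ℝ) : UnitAddCircle)‖ ≤ 2 * δ ∨ ‖x 1‖ ≤ 2 * δ ∨ ‖x 1 - ((2⁻¹ : ℝ) : UnitAddCircle)‖ ≤ 2 * δ)},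
            ∑ j, ‖Torus.partialDeriv j v x‖ ^ 2) →
      ∀ v : H3, v ∈ mirrorClass →
        Torus.eGradNormSq ((v : Lp (EuclideanSpace ℝ (Fin 3)) 2 (volume : Measure (UnitAddTorus (Fin 3)))) :
          UnitAddTorus (Fin 3) → EuclideanSpace ℝ (Fin 3)) ≠ ⊤ →
        ∀ Λv : ℝ≥0∞,
          (∀ w : Fin 3 → UnitAddTorus (Fin 3) → EuclideanSpace ℝ (Fin 3),
            (∀ j, Torus.HasWeakPartialDeriv j
              ((v : Lp (EuclideanSpace ℝ (Fin 3)) 2 (volume : Measure (UnitAddTorus (Fin 3)))) :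
                UnitAddTorus (Fin 3) → EuclideanSpace ℝ (Fin 3)) (w j)) →
            (∀ j, MemLp (w j) 2 volume) →
            ∫⁻ x in {x : UnitAddTorus (Fin 3) | ‖x 2‖ ≤ δ ∧ (‖x 0‖ ≤ 2 * δ ∨
                ‖x 0 - ((2⁻¹ : ℝ) : UnitAddCircle)‖ ≤ 2 * δ ∨ ‖x 1‖ ≤ 2 * δ ∨ ‖x 1 - ((2⁻¹ : ℝ) : UnitAddCircle)‖ ≤ 2 * δ)},
              ∑ j, ‖w j x‖ₑ ^ 2 ≤ Λv) →
          ENNReal.ofReal |Torus.inertialPairing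
              (v : Lp (EuclideanSpace ℝ (Fin 3)) 2 (volume : Measure (UnitAddTorus (Fin 3)))) g| ≤
            ENNReal.ofReal (C / δ) * Λv :=
  -- LANDED p162214 (Theorems/MirrorEnsembleMirrorStatisticsLoudTGStubTubeLawTransferK.lean)
  Summit.AnomalousDissipation.AnomalousDissipation.Theorems.MirrorEnsembleMirrorStatisticsLoudTG.stub_tubeLawTransferK

/-- **S3b `stub_noCuspK`** (OPEN — the cusped residue of S3) — NO EDGE CUSP: every K-supported stationary statistical
solution of the Euler equations forced by f_TG has, at arbitrarily small tube widths `δ`, mean local enstrophy on the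
skeleton tube `N_δ` below `c δ` for every `c > 0` (`liminf_{δ→0} δ⁻¹ E_μ ∫_{N_δ} |∇v|² = 0`). True for every
statistics carried (uniformly) by fields with `∇v ∈ L^{4+}` near `C` (`∫_{N_δ}|∇v|² = O(δ^{2−4/p})`); cusped
statistics (`|∇v|² ≍ dist(·,C)⁻¹`) are exactly what remains unexcluded. Equivalent to S3 given T1–T3 (S3 ⇒ S3b
vacuously). [doi:10.1017/s0022112083001159, FMRTTurbulence2001] -/
theorem stub_noCuspK :
    ∀ μ : Measure H3, μ (closure mirrorClass)ᶜ = 0 → Torus.IsStationaryStatisticalSolution 0 tgForce μ →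
      ∀ c δ₁ : ℝ, 0 < c → 0 < δ₁ → ∃ δ : ℝ, 0 < δ ∧ δ ≤ δ₁ ∧ ∃ Λ : H3 → ℝ≥0∞,
        (∀ v : H3, v ∈ mirrorClass →
          Torus.eGradNormSq ((v : Lp (EuclideanSpace ℝ (Fin 3)) 2 (volume : Measure (UnitAddTorus (Fin 3)))) :
            UnitAddTorus (Fin 3) → EuclideanSpace ℝ (Fin 3)) ≠ ⊤ →
          ∀ w : Fin 3 → UnitAddTorus (Fin 3) → EuclideanSpace ℝ (Fin 3),
            (∀ j, Torus.HasWeakPartialDeriv j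
              ((v : Lp (EuclideanSpace ℝ (Fin 3)) 2 (volume : Measure (UnitAddTorus (Fin 3)))) :
                UnitAddTorus (Fin 3) → EuclideanSpace ℝ (Fin 3)) (w j)) →
            (∀ j, MemLp (w j) 2 volume) →
            ∫⁻ x in {x : UnitAddTorus (Fin 3) | ‖x 2‖ ≤ δ ∧ (‖x 0‖ ≤ 2 * δ ∨
                ‖x 0 - ((2⁻¹ : ℝ) : UnitAddCircle)‖ ≤ 2 * δ ∨ ‖x 1‖ ≤ 2 * δ ∨ ‖x 1 - ((2⁻¹ : ℝ) : UnitAddCircle)‖ ≤ 2 * δ)},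
              ∑ j, ‖w j x‖ₑ ^ 2 ≤ Λ v) ∧
        ∫⁻ v, Λ v ∂μ < ENNReal.ofReal (c * δ) := by
  sorry

/-- **S3 from the tube law and the no-cusp residue** (`stub_eulerCoerciveK` of the original line, now DERIVED):
T1 gives the tube current `g` with `(f_TG, g) ≥ 1`, T2b∘T2a the smooth tube inequality with constant `K A³/δ`,
T3 its transfer to finite-enstrophy mirror classes, S3b a majorant `Λ` of the tube enstrophy with `∫ Λ dμ < cδ`;
the landed glue `skeletonLaw_of_tubeInequality` (mean Reynolds-stress balance on `Fix K`) then yields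
`1 ≤ (f_TG, g) ≤ (K A³/δ) ∫ Λ dμ < K A³ c ≤ ½`, absurd. -/
theorem eulerCoerciveK_of_tubeLaw
    (hT1 : ∃ A δ₁ : ℝ, 1 ≤ A ∧ 0 < δ₁ ∧ δ₁ ≤ 16⁻¹ ∧ ∀ δ : ℝ, 0 < δ → δ ≤ δ₁ →
      ∃ ρ η : ℝ → ℝ, ContDiff ℝ (⊤ : ℕ∞) ρ ∧ ContDiff ℝ (⊤ : ℕ∞) η ∧ Function.Periodic ρ 1 ∧ Function.Periodic η 1 ∧
        (∀ t, |η t| ≤ A / δ) ∧ (∀ t, |ρ t| ≤ 1) ∧ (∀ t, |deriv ρ t| ≤ A / δ) ∧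
        (∀ t, δ ≤ t → t ≤ 1 - δ → η t = 0) ∧
        (∀ t, 0 ≤ t → t ≤ 1 → deriv ρ t ≠ 0 → (δ < t ∧ t < 2 * δ) ∨ (2⁻¹ - 2 * δ < t ∧ t < 2⁻¹ - δ)) ∧
        Torus.IsSmooth (fun x : UnitAddTorus (Fin 3) =>
          !₂[η (Torus.repr x 2) * ρ (Torus.repr x 0) * deriv ρ (Torus.repr x 1),
             -(η (Torus.repr x 2) * deriv ρ (Torus.repr x 0) * ρ (Torus.repr x 1)), (0 : ℝ)]) ∧
        Torus.IsDivFree (fun x : UnitAddTorus (Fin 3) =>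
          !₂[η (Torus.repr x 2) * ρ (Torus.repr x 0) * deriv ρ (Torus.repr x 1),
             -(η (Torus.repr x 2) * deriv ρ (Torus.repr x 0) * ρ (Torus.repr x 1)), (0 : ℝ)]) ∧
        Torus.HasZeroMean (fun x : UnitAddTorus (Fin 3) =>
          !₂[η (Torus.repr x 2) * ρ (Torus.repr x 0) * deriv ρ (Torus.repr x 1),
             -(η (Torus.repr x 2) * deriv ρ (Torus.repr x 0) * ρ (Torus.repr x 1)), (0 : ℝ)]) ∧
        1 ≤ ∫ x, ⟪tgForce x, !₂[η (Torus.repr x 2) * ρ (Torus.repr x 0) * deriv ρ (Torus.repr x 1),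
             -(η (Torus.repr x 2) * deriv ρ (Torus.repr x 0) * ρ (Torus.repr x 1)), (0 : ℝ)]⟫_ℝ)
    (hT2 : ∃ K : ℝ, 0 < K ∧ ∀ (A δ : ℝ) (ρ η : ℝ → ℝ), 1 ≤ A → 0 < δ → δ ≤ 16⁻¹ →
      ContDiff ℝ (⊤ : ℕ∞) ρ → ContDiff ℝ (⊤ : ℕ∞) η → Function.Periodic ρ 1 → Function.Periodic η 1 →
      (∀ t, |η t| ≤ A / δ) → (∀ t, |ρ t| ≤ 1) → (∀ t, |deriv ρ t| ≤ A / δ) →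
      (∀ t, δ ≤ t → t ≤ 1 - δ → η t = 0) →
      (∀ t, 0 ≤ t → t ≤ 1 → deriv ρ t ≠ 0 → (δ < t ∧ t < 2 * δ) ∨ (2⁻¹ - 2 * δ < t ∧ t < 2⁻¹ - δ)) →
      ∀ v : UnitAddTorus (Fin 3) → EuclideanSpace ℝ (Fin 3), Torus.IsSmooth v → Torus.IsDivFree v →
        Torus.HasZeroMean v →
        (∀ (i j : Fin 3) (x : UnitAddTorus (Fin 3)), v (Function.update x i (-x i)) j = if j = i then -(v x j) else v x j) →
        |∫ x, ⟪Torus.fderiv (fun y : UnitAddTorus (Fin 3) =>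
            !₂[η (Torus.repr y 2) * ρ (Torus.repr y 0) * deriv ρ (Torus.repr y 1),
               -(η (Torus.repr y 2) * deriv ρ (Torus.repr y 0) * ρ (Torus.repr y 1)), (0 : ℝ)]) x (v x), v x⟫_ℝ| ≤
          K * A ^ 3 / δ * ∫ x in {x : UnitAddTorus (Fin 3) | ‖x 2‖ ≤ δ ∧ (‖x 0‖ ≤ 2 * δ ∨
              ‖x 0 - ((2⁻¹ : ℝ) : UnitAddCircle)‖ ≤ 2 * δ ∨ ‖x 1‖ ≤ 2 * δ ∨ ‖x 1 - ((2⁻¹ : ℝ) : UnitAddCircle)‖ ≤ 2 * δ)},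
            ∑ j, ‖Torus.partialDeriv j v x‖ ^ 2)
    (hT3 : ∀ (C δ : ℝ) (g : UnitAddTorus (Fin 3) → EuclideanSpace ℝ (Fin 3)), 0 ≤ C → 0 < δ → Torus.IsSmooth g →
      (∀ v : UnitAddTorus (Fin 3) → EuclideanSpace ℝ (Fin 3), Torus.IsSmooth v → Torus.IsDivFree v →
        Torus.HasZeroMean v →
        (∀ (i j : Fin 3) (x : UnitAddTorus (Fin 3)), v (Function.update x i (-x i)) j = if j = i then -(v x j) else v x j) →
        |∫ x, ⟪Torus.fderiv g x (v x), v x⟫_ℝ| ≤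
          C / δ * ∫ x in {x : UnitAddTorus (Fin 3) | ‖x 2‖ ≤ δ ∧ (‖x 0‖ ≤ 2 * δ ∨
              ‖x 0 - ((2⁻¹ : ℝ) : UnitAddCircle)‖ ≤ 2 * δ ∨ ‖x 1‖ ≤ 2 * δ ∨ ‖x 1 - ((2⁻¹ : ℝ) : UnitAddCircle)‖ ≤ 2 * δ)},
            ∑ j, ‖Torus.partialDeriv j v x‖ ^ 2) →
      ∀ v : H3, v ∈ mirrorClass →
        Torus.eGradNormSq ((v : Lp (EuclideanSpace ℝ (Fin 3)) 2 (volume : Measure (UnitAddTorus (Fin 3)))) :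
          UnitAddTorus (Fin 3) → EuclideanSpace ℝ (Fin 3)) ≠ ⊤ →
        ∀ Λv : ℝ≥0∞,
          (∀ w : Fin 3 → UnitAddTorus (Fin 3) → EuclideanSpace ℝ (Fin 3),
            (∀ j, Torus.HasWeakPartialDeriv j
              ((v : Lp (EuclideanSpace ℝ (Fin 3)) 2 (volume : Measure (UnitAddTorus (Fin 3)))) :
                UnitAddTorus (Fin 3) → EuclideanSpace ℝ (Fin 3)) (w j)) →
            (∀ j, MemLp (w j) 2 volume) →
            ∫⁻ x in {x : UnitAddTorus (Fin 3) | ‖x 2‖ ≤ δ ∧ (‖x 0‖ ≤ 2 * δ ∨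
                ‖x 0 - ((2⁻¹ : ℝ) : UnitAddCircle)‖ ≤ 2 * δ ∨ ‖x 1‖ ≤ 2 * δ ∨ ‖x 1 - ((2⁻¹ : ℝ) : UnitAddCircle)‖ ≤ 2 * δ)},
              ∑ j, ‖w j x‖ₑ ^ 2 ≤ Λv) →
          ENNReal.ofReal |Torus.inertialPairing
              (v : Lp (EuclideanSpace ℝ (Fin 3)) 2 (volume : Measure (UnitAddTorus (Fin 3)))) g| ≤
            ENNReal.ofReal (C / δ) * Λv)
    (hS3b : ∀ μ : Measure H3, μ (closure mirrorClass)ᶜ = 0 → Torus.IsStationaryStatisticalSolution 0 tgForce μ →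
      ∀ c δ₁ : ℝ, 0 < c → 0 < δ₁ → ∃ δ : ℝ, 0 < δ ∧ δ ≤ δ₁ ∧ ∃ Λ : H3 → ℝ≥0∞,
        (∀ v : H3, v ∈ mirrorClass →
          Torus.eGradNormSq ((v : Lp (EuclideanSpace ℝ (Fin 3)) 2 (volume : Measure (UnitAddTorus (Fin 3)))) :
            UnitAddTorus (Fin 3) → EuclideanSpace ℝ (Fin 3)) ≠ ⊤ →
          ∀ w : Fin 3 → UnitAddTorus (Fin 3) → EuclideanSpace ℝ (Fin 3),
            (∀ j, Torus.HasWeakPartialDeriv j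
              ((v : Lp (EuclideanSpace ℝ (Fin 3)) 2 (volume : Measure (UnitAddTorus (Fin 3)))) :
                UnitAddTorus (Fin 3) → EuclideanSpace ℝ (Fin 3)) (w j)) →
            (∀ j, MemLp (w j) 2 volume) →
            ∫⁻ x in {x : UnitAddTorus (Fin 3) | ‖x 2‖ ≤ δ ∧ (‖x 0‖ ≤ 2 * δ ∨
                ‖x 0 - ((2⁻¹ : ℝ) : UnitAddCircle)‖ ≤ 2 * δ ∨ ‖x 1‖ ≤ 2 * δ ∨ ‖x 1 - ((2⁻¹ : ℝ) : UnitAddCircle)‖ ≤ 2 * δ)},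
              ∑ j, ‖w j x‖ₑ ^ 2 ≤ Λ v) ∧
        ∫⁻ v, Λ v ∂μ < ENNReal.ofReal (c * δ)) :
    ∀ μ : Measure H3, μ (closure mirrorClass)ᶜ = 0 → ¬ Torus.IsStationaryStatisticalSolution 0 tgForce μ := by
  intro μ hK hμ
  obtain ⟨A, δ₁, hA, hδ₁, hδ₁le, hprof⟩ := hT1
  obtain ⟨K, hK0, htube⟩ := hT2
  -- the constant of the transferred tube inequality and the smallness target
  set C : ℝ := K * A ^ 3 with hC
  have hCpos : 0 < C := by positivity
  obtain ⟨δ, hδ, hδle, Λ, hΛ, hmean⟩ := hS3b μ hK hμ (1 / (2 * C)) δ₁ (by positivity) hδ₁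
  have hδ16 : δ ≤ 16⁻¹ := hδle.trans hδ₁le
  obtain ⟨ρ, η, hρs, hηs, hρp, hηp, hηb, hρb, hρ'b, hηsupp, hρ'supp, hgs, hgd, hgz, hfg⟩ := hprof δ hδ hδle
  -- the smooth tube inequality for the tube current of these profiles, and its transfer
  have hsmooth := htube A δ ρ η hA hδ hδ16 hρs hηs hρp hηp hηb hρb hρ'b hηsupp hρ'supp
  have htrans := hT3 C δ _ hCpos.le hδ hgs hsmooth
  -- the statistical skeleton law with `Λ' = (C/δ) Λ`
  have key := Summit.AnomalousDissipation.AnomalousDissipation.Theorems.MirrorEnsembleMirrorStatisticsLoudTG.skeletonLaw_of_tubeInequality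
    _ (fun v => ENNReal.ofReal (C / δ) * Λ v) hgs hgd hgz
    (fun v hv hfin => htrans v hv hfin (Λ v) (fun w hw hw2 => hΛ v hv hfin w hw hw2)) μ hK hμ
  rw [lintegral_const_mul' _ _ ENNReal.ofReal_ne_top] at key
  -- `1 ≤ (f_TG, g) ≤ (C/δ) ∫ Λ < (C/δ) (δ/(2C)) = 1/2`
  have h1 : ENNReal.ofReal 1 ≤ ENNReal.ofReal (C / δ) * ∫⁻ v, Λ v ∂μ :=
    (ENNReal.ofReal_le_ofReal hfg).trans key
  have h2 : ENNReal.ofReal (C / δ) * ∫⁻ v, Λ v ∂μ < ENNReal.ofReal (C / δ) * ENNReal.ofReal (1 / (2 * C) * δ) := by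
    rw [mul_comm (ENNReal.ofReal (C / δ)), mul_comm (ENNReal.ofReal (C / δ))]
    exact ENNReal.mul_lt_mul_left (ENNReal.ofReal_pos.2 (by positivity)).ne' ENNReal.ofReal_ne_top hmean
  have h3 : ENNReal.ofReal (C / δ) * ENNReal.ofReal (1 / (2 * C) * δ) = ENNReal.ofReal 2⁻¹ := by
    rw [← ENNReal.ofReal_mul (by positivity)]
    congr 1
    field_simp
  have h4 : ENNReal.ofReal 1 < ENNReal.ofReal 2⁻¹ := by
    calc ENNReal.ofReal 1 ≤ _ := h1
      _ < _ := h2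
      _ = _ := h3
  have h5 := (ENNReal.ofReal_lt_ofReal_iff (by norm_num)).1 h4
  norm_num at h5

/-- **S3 `stub_eulerCoerciveK`** of the original line, DERIVED (lead, cycle 1) from T1, T2a, T2b, T3 and the open
residue S3b: f_TG is Euler-coercive in the mirror class. -/
theorem stub_eulerCoerciveK :
    ∀ μ : Measure H3, μ (closure mirrorClass)ᶜ = 0 → ¬ Torus.IsStationaryStatisticalSolution 0 tgForce μ :=
  eulerCoerciveK_of_tubeLaw stub_tubeProfilesK (stub_tubeLawSmoothK stub_oddPoincareK) stub_tubeLawTransferK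
    stub_noCuspK

/-- **S4 `stub_roughLoudK`** (OPEN; the heart) — ROUGH BOUNDED MIRROR STATISTICS ARE LOUD: for every `E` there are a
mean-enstrophy threshold `G₁` and `ε₀, ν₀ > 0` such that every stationary statistical solution of NS_ν(f_TG),
`0 < ν < ν₀`, with integrable energy `≤ E`, carried by `closure Fix K` and with `G(μ) ≥ G₁` has `ν G(μ) ≥ ε₀`.
Strictly weaker than L_K (one more hypothesis); by S1–S3 the only regime that is inhabited for small `ν`.
[FMRTTurbulence2001, arXiv:2311.04182, arXiv:1305.7089, doi:10.1103/physreve.77.036306] -/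
theorem stub_roughLoudK :
    ∀ E : ℝ, ∃ G₁ ε₀ ν₀ : ℝ, 0 < ε₀ ∧ 0 < ν₀ ∧ ∀ ν : ℝ, 0 < ν → ν < ν₀ →
      ∀ μ : Measure H3, Torus.IsStationaryStatisticalSolution ν tgForce μ →
        Integrable (fun v : H3 => ‖v‖ ^ 2) μ → Torus.ensembleEnergy μ ≤ E →
        μ (closure mirrorClass)ᶜ = 0 → ENNReal.ofReal G₁ ≤ Torus.ensembleEnstrophy μ →
        ε₀ ≤ Torus.ensembleDissipation ν μ := by
  sorry

/-! ## Composition -/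

/-- **Tame exclusion** from S1–S3: at level `E` and threshold `G₁ ≥ 0`, below some `ν₁ > 0` no K-supported
stationary statistical solution of NS_ν(f_TG) with integrable energy `≤ E` has mean enstrophy `< G₁`. -/
theorem tame_exclusion
    (hRes : ∀ (ν : ℝ) (μ : Measure H3), 0 < ν → Torus.IsStationaryStatisticalSolution ν tgForce μ →
      Integrable (fun v : H3 => ‖v‖ ^ 2) μ →
      ∀ Φ : Torus.CylindricalTest (Fin 3),
        Integrable (fun v : H3 => Torus.nsGeneratorPairing 0 tgForce v (Φ.grad v)) μ ∧
          |∫ v, Torus.nsGeneratorPairing 0 tgForce v (Φ.grad v) ∂μ| ≤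
            ν * Real.sqrt (Torus.ensembleEnstrophy μ).toReal *
              Real.sqrt (∫ v, Torus.gradNormSq (Φ.grad v) ∂μ))
    (hK : ∀ E G₁ : ℝ,
      (∀ r : ℝ, 0 < r → ∃ μ : Measure H3, IsProbabilityMeasure μ ∧
        Integrable (fun v : H3 => ‖v‖ ^ 2) μ ∧ Torus.ensembleEnergy μ ≤ E ∧
        Torus.ensembleEnstrophy μ ≤ ENNReal.ofReal G₁ ∧ μ (closure mirrorClass)ᶜ = 0 ∧
        (∀ Φ : Torus.CylindricalTest (Fin 3),
          Integrable (fun v : H3 => Torus.nsGeneratorPairing 0 tgForce v (Φ.grad v)) μ ∧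
            |∫ v, Torus.nsGeneratorPairing 0 tgForce v (Φ.grad v) ∂μ| ≤
              r * Real.sqrt (∫ v, Torus.gradNormSq (Φ.grad v) ∂μ))) →
      ∃ μ : Measure H3, Torus.IsStationaryStatisticalSolution 0 tgForce μ ∧
        Integrable (fun v : H3 => ‖v‖ ^ 2) μ ∧ Torus.ensembleEnergy μ ≤ E ∧
        Torus.ensembleEnstrophy μ ≤ ENNReal.ofReal G₁ ∧ μ (closure mirrorClass)ᶜ = 0)
    (hN : ∀ μ : Measure H3, μ (closure mirrorClass)ᶜ = 0 → ¬ Torus.IsStationaryStatisticalSolution 0 tgForce μ)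
    (E G₁ : ℝ) (hG₁ : 0 ≤ G₁) :
    ∃ ν₁ : ℝ, 0 < ν₁ ∧ ∀ ν : ℝ, 0 < ν → ν < ν₁ →
      ∀ μ : Measure H3, Torus.IsStationaryStatisticalSolution ν tgForce μ →
        Integrable (fun v : H3 => ‖v‖ ^ 2) μ → Torus.ensembleEnergy μ ≤ E →
        μ (closure mirrorClass)ᶜ = 0 → ENNReal.ofReal G₁ ≤ Torus.ensembleEnstrophy μ := by
  by_contra h
  push Not at h
  -- every `r > 0` admits a K-supported tame near-statistics with defect `≤ r` (through the residual transfer)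
  have hnear : ∀ r : ℝ, 0 < r → ∃ μ : Measure H3, IsProbabilityMeasure μ ∧
      Integrable (fun v : H3 => ‖v‖ ^ 2) μ ∧ Torus.ensembleEnergy μ ≤ E ∧
      Torus.ensembleEnstrophy μ ≤ ENNReal.ofReal G₁ ∧ μ (closure mirrorClass)ᶜ = 0 ∧
      (∀ Φ : Torus.CylindricalTest (Fin 3),
        Integrable (fun v : H3 => Torus.nsGeneratorPairing 0 tgForce v (Φ.grad v)) μ ∧
          |∫ v, Torus.nsGeneratorPairing 0 tgForce v (Φ.grad v) ∂μ| ≤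
            r * Real.sqrt (∫ v, Torus.gradNormSq (Φ.grad v) ∂μ)) := by
    intro r hr
    have hden : 0 < Real.sqrt G₁ + 1 := by positivity
    obtain ⟨ν, hν, hνlt, μ, hμ, hint, hE, hS, hG⟩ := h (r / (Real.sqrt G₁ + 1)) (by positivity)
    refine ⟨μ, hμ.prob, hint, hE, hG.le, hS, fun Φ => ?_⟩
    obtain ⟨hI, hdef⟩ := hRes ν μ hν hμ hint Φ
    refine ⟨hI, hdef.trans ?_⟩
    -- `ν √(G.toReal) ≤ r`
    have hGreal : (Torus.ensembleEnstrophy μ).toReal ≤ G₁ := ENNReal.toReal_le_of_le_ofReal hG₁ hG.le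
    have hνG : ν * Real.sqrt (Torus.ensembleEnstrophy μ).toReal ≤ r := by
      calc ν * Real.sqrt (Torus.ensembleEnstrophy μ).toReal
          ≤ (r / (Real.sqrt G₁ + 1)) * (Real.sqrt G₁ + 1) := by
            refine mul_le_mul hνlt.le ((Real.sqrt_le_sqrt hGreal).trans (by linarith))
              (Real.sqrt_nonneg _) (by positivity)
        _ = r := div_mul_cancel₀ r hden.ne'
    exact mul_le_mul_of_nonneg_right hνG (Real.sqrt_nonneg _)
  obtain ⟨μ₀, hsss, -, -, -, hS₀⟩ := hK E G₁ hnear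
  exact hN μ₀ hS₀ hsss

/-- **The mirror regime split**, sorry-free in its own right: S1 → S2 → S3 → S4 → the `∀ E ∃ ε₀ ν₀` body of L_K
(`LoudAt` of `Negative/LoadBearing`; `crux_iff` re-attaches the sugar binder `∀ f, f = f_TG →`). -/
theorem mirrorStatisticsLoudTG_of_regimes
    (hRes : ∀ (ν : ℝ) (μ : Measure H3), 0 < ν → Torus.IsStationaryStatisticalSolution ν tgForce μ →
      Integrable (fun v : H3 => ‖v‖ ^ 2) μ →
      ∀ Φ : Torus.CylindricalTest (Fin 3),
        Integrable (fun v : H3 => Torus.nsGeneratorPairing 0 tgForce v (Φ.grad v)) μ ∧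
          |∫ v, Torus.nsGeneratorPairing 0 tgForce v (Φ.grad v) ∂μ| ≤
            ν * Real.sqrt (Torus.ensembleEnstrophy μ).toReal *
              Real.sqrt (∫ v, Torus.gradNormSq (Φ.grad v) ∂μ))
    (hK : ∀ E G₁ : ℝ,
      (∀ r : ℝ, 0 < r → ∃ μ : Measure H3, IsProbabilityMeasure μ ∧
        Integrable (fun v : H3 => ‖v‖ ^ 2) μ ∧ Torus.ensembleEnergy μ ≤ E ∧
        Torus.ensembleEnstrophy μ ≤ ENNReal.ofReal G₁ ∧ μ (closure mirrorClass)ᶜ = 0 ∧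
        (∀ Φ : Torus.CylindricalTest (Fin 3),
          Integrable (fun v : H3 => Torus.nsGeneratorPairing 0 tgForce v (Φ.grad v)) μ ∧
            |∫ v, Torus.nsGeneratorPairing 0 tgForce v (Φ.grad v) ∂μ| ≤
              r * Real.sqrt (∫ v, Torus.gradNormSq (Φ.grad v) ∂μ))) →
      ∃ μ : Measure H3, Torus.IsStationaryStatisticalSolution 0 tgForce μ ∧
        Integrable (fun v : H3 => ‖v‖ ^ 2) μ ∧ Torus.ensembleEnergy μ ≤ E ∧
        Torus.ensembleEnstrophy μ ≤ ENNReal.ofReal G₁ ∧ μ (closure mirrorClass)ᶜ = 0)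
    (hN : ∀ μ : Measure H3, μ (closure mirrorClass)ᶜ = 0 → ¬ Torus.IsStationaryStatisticalSolution 0 tgForce μ)
    (hR : ∀ E : ℝ, ∃ G₁ ε₀ ν₀ : ℝ, 0 < ε₀ ∧ 0 < ν₀ ∧ ∀ ν : ℝ, 0 < ν → ν < ν₀ →
      ∀ μ : Measure H3, Torus.IsStationaryStatisticalSolution ν tgForce μ →
        Integrable (fun v : H3 => ‖v‖ ^ 2) μ → Torus.ensembleEnergy μ ≤ E →
        μ (closure mirrorClass)ᶜ = 0 → ENNReal.ofReal G₁ ≤ Torus.ensembleEnstrophy μ →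
        ε₀ ≤ Torus.ensembleDissipation ν μ) :
    ∀ E : ℝ, ∃ ε₀ ν₀ : ℝ, 0 < ε₀ ∧ 0 < ν₀ ∧ LoudAt E ε₀ ν₀ := by
  intro E
  obtain ⟨G₁, ε₀, ν₀, hε₀, hν₀, hrough⟩ := hR E
  -- the threshold made non-negative (the rough stub only gets easier)
  obtain ⟨ν₁, hν₁, htame⟩ := tame_exclusion hRes hK hN E (max G₁ 0) (le_max_right _ _)
  refine ⟨ε₀, min ν₀ ν₁, hε₀, lt_min hν₀ hν₁, ?_⟩
  intro ν hν hνlt μ hμ hint hE hS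
  have hbig : ENNReal.ofReal G₁ ≤ Torus.ensembleEnstrophy μ :=
    (ENNReal.ofReal_le_ofReal (le_max_left G₁ 0)).trans
      (htame ν hν (hνlt.trans_le (min_le_right _ _)) μ hμ hint hE hS)
  exact hrough ν hν (hνlt.trans_le (min_le_left _ _)) μ hμ hint hE hS hbig

/-- **L_K — `MirrorEnsemble.MirrorStatisticsLoudTG`** (item stmt-AnomalousDissipation-17693) BY NAME from the four stubs. -/
theorem MirrorStatisticsLoudTG_of :
    Summit.AnomalousDissipation.AnomalousDissipation.Theses.MirrorEnsemble.MirrorStatisticsLoudTG :=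
  crux_iff.2 (mirrorStatisticsLoudTG_of_regimes stub_residualK stub_tameClosureK stub_eulerCoerciveK stub_roughLoudK)

/- Local skeleton audit (run with `import HarnessLib.Audit`; removed from the published file because the crux-write
elaborator does not load the audit commands):
#h21_check_skeleton "stmt-AnomalousDissipation-17693"
  Summit.AnomalousDissipation.AnomalousDissipation.Theses.MirrorEnsemble.MirrorStatisticsLoudTG
  stub_residualK stub_tameClosureK stub_eulerCoerciveK stub_roughLoudK
→ ok = true, codes = [], theorem = …Regimes.MirrorStatisticsLoudTG_of (strategist folder check, 2026-08-17T09:3xZ). -/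

end Summit.AnomalousDissipation.AnomalousDissipation.Cruxes.MirrorStatisticsLoudTG.Regimes

end
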